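import Mathlib
import Literature.NumberTheory.Transcendental.SemialgebraicLineDeriv
import Summits.KontsevichZagierPeriods.KontsevichZagierPeriods.Theorems.TorsionLogsNeronTorsionSectorStubTranslationStep
import Summits.KontsevichZagierPeriods.KontsevichZagierPeriods.Theorems.TorsionLogsNeronTorsionSectorStubSigmaChart
import Summits.KontsevichZagierPeriods.KontsevichZagierPeriods.Theorems.TorsionLogsNeronTorsionSectorStubCornerChartLower
import HarnessLib

/-!
# Stub `stub_chartTransportInst` — crux `TorsionLogs.NeronTorsionSector`, line `registered` (block S7)

The two CHART TRANSPORTS of the corner cell of the translation chain on the real torus of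
`y² = 4x³ − g₂x − g₃` in the compactifying chart `x = s⁻²` at infinity (no potential): `x′ = s′⁻²` carries
`Cmix = [(al,ar) × (0,s₁), ĥ(s′)(√f x)⁻¹(2/R s′)]` to `Cx = [(al,ar) × (x₁,∞), h(x′)/(√f x √f x′)]`, and
`(x, x′) = (s⁻², s′⁻²)` carries `B00 = [(0,s₁)², ĥ(s′)(2/R s)(2/R s′)]` to `Bx = [(x₁,∞)², h(x′)/(√f x √f x′)]`
(`h(x) = (g₂x + 2g₃)/(4x²)`, `ĥ(s) = h(s⁻²) = (g₂s² + 2g₃s⁴)/4`, `R(s) = s³√f(s⁻²) > 0` on `[0, s₁]`,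
`s₁⁻² = x₁`). Each is ONE application of the landed `stub_translationStep` with fibre map
`ψ(v) = (v²)⁻¹ : (0,s₁) → (x₁,∞)` (Haar identity `(√f(v⁻²))⁻¹·|−2/v³| = 2/R v`), kernels `kS = ĥ`, `kT = h`,
`kT ∘ ψ = kS`, hence potential `Q = 0`; the output rep has zero integrand and is itself a relation
(`KZ.of_mem_relations_of_eqOn_zero`). References: M. Kontsevich, D. Zagier, *Periods* (2001), §1.2;
J. Bochnak, M. Coste, M.-F. Roy, *Real Algebraic Geometry* (1998), Prop. 2.2.6.
-/

noncomputable section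

-- `Summit.KontsevichZagierPeriods.KontsevichZagierPeriods.…` is the tree's mandated layout (single-conjunct summit).
set_option linter.dupNamespace false

open Set MeasureTheory MvPolynomial
open Literature.NumberTheory.Transcendental Literature.ModelTheory.ExponentialFields
open Literature.NumberTheory.Transcendental.KZ

namespace Summit.KontsevichZagierPeriods.KontsevichZagierPeriods.Cruxes.NeronTorsionSector.Translation

/-- The chart weight `2/R` is `ℚ`-semialgebraic on `(0, s₁)` when `R` is `ℚ`-semialgebraic on `[0, s₁]`
(junk-tolerant inverse, `IsSemialgebraicFunOn.fun_inv`). [cite: BochnakCosteRoy1998, Prop. 2.2.6] -/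
theorem chartTr_sa_twoDivR {s₁ : ℝ} {R : ℝ → ℝ} (hs₁ : IsAlgebraic ℚ s₁)
    (hRsa : IsSemialgebraicFunOn ℚ {t : Fin 1 → ℝ | t 0 ∈ Icc 0 s₁} (fun t => R (t 0))) :
    IsSemialgebraicFunOn ℚ {t : Fin 1 → ℝ | t 0 ∈ Ioo 0 s₁} (fun t => 2 / R (t 0)) := by
  have hB : IsSemialgebraic ℚ {t : Fin 1 → ℝ | t 0 ∈ Ioo 0 s₁} :=
    (isSemialgebraic_setOf_const_lt_apply isAlgebraic_zero 0).inter
      (isSemialgebraic_setOf_apply_lt_const hs₁ 0)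
  exact ((isSemialgebraicFunOn_const_ofNat hB 2).fun_mul
    (hRsa.mono (fun _ ht => Ioo_subset_Icc_self ht) hB).fun_inv).congr
    fun _ _ => (div_eq_mul_inv _ _).symm

/-- **Surjectivity of the chart** `s ↦ (s²)⁻¹ : (0, s₁) → (x₁, ∞)` (`s₁² x₁ = 1`): every `x > x₁` is
`(s²)⁻¹` for `s = (√x)⁻¹ ∈ (0, s₁)`. [cite: KontsevichZagier2001, §1.2] -/
theorem chartTr_exists_sq_inv {x₁ s₁ x : ℝ} (hs₁ : 0 < s₁) (hsx : s₁ ^ 2 * x₁ = 1) (hx : x₁ < x) :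
    ∃ s, (0 < s ∧ s < s₁) ∧ (s ^ 2)⁻¹ = x := by
  have hx₁ : 0 < x₁ := by
    rw [eq_inv_of_mul_eq_one_right hsx]
    positivity
  have hx0 : 0 < x := hx₁.trans hx
  have hsq : (Real.sqrt x)⁻¹ ^ 2 * x = 1 := by
    rw [inv_pow, Real.sq_sqrt hx0.le, inv_mul_cancel₀ hx0.ne']
  have hspos : 0 < (Real.sqrt x)⁻¹ := inv_pos.2 (Real.sqrt_pos.2 hx0)
  refine ⟨(Real.sqrt x)⁻¹, ⟨hspos, ?_⟩, ?_⟩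
  · by_contra hle
    have h1 : x ≤ (s₁ ^ 2)⁻¹ := sigmaChart_le_inv_sq hsq hs₁ (not_lt.1 hle)
    rw [← eq_inv_of_mul_eq_one_right hsx] at h1
    exact absurd hx (not_lt.2 h1)
  · rw [inv_pow, Real.sq_sqrt hx0.le, inv_inv]

/-- **Injectivity of the chart** `v ↦ (v²)⁻¹` on `(0, s₁)`. [cite: KontsevichZagier2001, §1.2] -/
theorem chartTr_injOn_invSq (s₁ : ℝ) : InjOn (fun v : ℝ => (v ^ 2)⁻¹) (Ioo 0 s₁) := by
  intro a ha b hb h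
  have h2 : a ^ 2 = b ^ 2 := inv_injective h
  have h3 := (sq_eq_sq_iff_abs_eq_abs a b).1 h2
  rwa [abs_of_pos ha.1, abs_of_pos hb.1] at h3

/-- **Derivative and Haar identity of the chart**: on `(0, s₁)`, `ψ(v) = (v²)⁻¹` has derivative
`−2/v³`, and `(√f((v²)⁻¹))⁻¹ · |−2/v³| = 2/R v` because `√f((v²)⁻¹) = R v/v³`.
[cite: KontsevichZagier2001, §1.2 rule (2)] -/
theorem chartTr_hasDerivAt_haar {f R : ℝ → ℝ} {s₁ : ℝ}
    (hR : ∀ s, 0 < s → s ≤ s₁ → Real.sqrt (f (s ^ 2)⁻¹) = R s / s ^ 3) :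
    ∀ v ∈ Ioo 0 s₁, HasDerivAt (fun t : ℝ => (t ^ 2)⁻¹) (-2 / v ^ 3) v ∧
      (Real.sqrt (f ((v ^ 2)⁻¹)))⁻¹ * |(-2) / v ^ 3| = 2 / R v := by
  intro v hv
  refine ⟨sigmaChart_hasDerivAt_inv_sq hv.1.ne', ?_⟩
  have hv3 : 0 < v ^ 3 := pow_pos hv.1 3
  rw [hR v hv.1 hv.2.le, abs_div, abs_neg, abs_two, abs_of_pos hv3, inv_div, div_mul_div_comm,
    mul_comm (v ^ 3) 2, mul_div_mul_right _ _ hv3.ne']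

/-- The chart weight `2/R` is integrable on `(0, s₁)` (continuous with positive denominator on the
compact `[0, s₁]`). [cite: KontsevichZagier2001, §1.1] -/
theorem chartTr_integrableOn_twoDivR {R : ℝ → ℝ} {s₁ : ℝ} (hRc : ContinuousOn R (Icc 0 s₁))
    (hRpos : ∀ s ∈ Icc 0 s₁, 0 < R s) : IntegrableOn (fun v => 2 / R v) (Ioo 0 s₁) := by
  have hc : ContinuousOn (fun v => 2 / R v) (Icc 0 s₁) :=
    continuousOn_const.div hRc fun s hs => (hRpos s hs).ne'
  exact hc.integrableOn_Icc.mono_set Ioo_subset_Icc_self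

/-- The chart kernel is bounded on `(0, s₁)` by the bound of `h` right of `e₁`:
`|ĥ(v)| = |h((v²)⁻¹)| ≤ Cb` since `(v²)⁻¹ > x₁ > e₁`. [cite: KontsevichZagier2001, §1.1] -/
theorem chartTr_hHat_bound {g₂ g₃ e₁ x₁ s₁ Cb : ℝ} (hex : e₁ < x₁) (hsx : s₁ ^ 2 * x₁ = 1)
    (hCb : ∀ x, e₁ < x → |(g₂ * x + 2 * g₃) / (4 * x ^ 2)| ≤ Cb) :
    ∀ v ∈ Ioo 0 s₁, |(g₂ * v ^ 2 + 2 * g₃ * v ^ 4) / 4| ≤ Cb := by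
  intro v hv
  have hv0 : v ≠ 0 := hv.1.ne'
  -- the kernel identity `ĥ(v) = h((v²)⁻¹)` (as in `cellStepZero_hhat_eq`)
  have hk : (g₂ * v ^ 2 + 2 * g₃ * v ^ 4) / 4 =
      (g₂ * (v ^ 2)⁻¹ + 2 * g₃) / (4 * ((v ^ 2)⁻¹) ^ 2) := by
    field_simp
  rw [hk]
  exact hCb _ (hex.trans (sigmaChart_lt_inv_sq hsx hv.1 hv.2))

/-- Image of the mixed cell: `(x, s′) ↦ (x, (s′²)⁻¹)` maps `(al, ar) × (0, s₁)` onto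
`(al, ar) × (x₁, ∞)`. [cite: KontsevichZagier2001, §1.2 rule (2)] -/
theorem chartTr_image_mixed {al ar x₁ s₁ : ℝ} (hs₁ : 0 < s₁) (hsx : s₁ ^ 2 * x₁ = 1) :
    (fun z : Fin 2 → ℝ => (![z 0, ((z 1) ^ 2)⁻¹] : Fin 2 → ℝ)) ''
        {z : Fin 2 → ℝ | (al < z 0 ∧ z 0 < ar) ∧ 0 < z 1 ∧ z 1 < s₁} =
      {z | (al < z 0 ∧ z 0 < ar) ∧ x₁ < z 1} := by
  ext w
  constructor
  · rintro ⟨z, ⟨h0, h1a, h1b⟩, rfl⟩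
    simp only [mem_setOf_eq, Matrix.cons_val_zero, Matrix.cons_val_one]
    exact ⟨h0, sigmaChart_lt_inv_sq hsx h1a h1b⟩
  · rintro ⟨h0, h1⟩
    obtain ⟨s, ⟨hs0, hs1⟩, hsw⟩ := chartTr_exists_sq_inv hs₁ hsx h1
    refine ⟨![w 0, s], ?_, ?_⟩
    · simp only [mem_setOf_eq, Matrix.cons_val_zero, Matrix.cons_val_one]
      exact ⟨h0, hs0, hs1⟩
    · ext i
      fin_cases i
      · simp
      · simp [hsw]

/-- Image of the chart square: `(s, s′) ↦ ((s²)⁻¹, (s′²)⁻¹)` maps `(0, s₁)²` onto `(x₁, ∞)²`.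
[cite: KontsevichZagier2001, §1.2 rule (2)] -/
theorem chartTr_image_square {x₁ s₁ : ℝ} (hs₁ : 0 < s₁) (hsx : s₁ ^ 2 * x₁ = 1) :
    (fun z : Fin 2 → ℝ => (![((z 0) ^ 2)⁻¹, ((z 1) ^ 2)⁻¹] : Fin 2 → ℝ)) ''
        {z : Fin 2 → ℝ | (0 < z 0 ∧ z 0 < s₁) ∧ 0 < z 1 ∧ z 1 < s₁} =
      {z | x₁ < z 0 ∧ x₁ < z 1} := by
  ext w
  constructor
  · rintro ⟨z, ⟨⟨h0a, h0b⟩, h1a, h1b⟩, rfl⟩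
    simp only [mem_setOf_eq, Matrix.cons_val_zero, Matrix.cons_val_one]
    exact ⟨sigmaChart_lt_inv_sq hsx h0a h0b, sigmaChart_lt_inv_sq hsx h1a h1b⟩
  · rintro ⟨h0, h1⟩
    obtain ⟨s, ⟨hs0, hs1⟩, hsw⟩ := chartTr_exists_sq_inv hs₁ hsx h0
    obtain ⟨s', ⟨hs0', hs1'⟩, hsw'⟩ := chartTr_exists_sq_inv hs₁ hsx h1
    refine ⟨![s, s'], ?_, ?_⟩
    · simp only [mem_setOf_eq, Matrix.cons_val_zero, Matrix.cons_val_one]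
      exact ⟨⟨hs0, hs1⟩, hs0', hs1'⟩
    · ext i
      fin_cases i
      · simp [hsw]
      · simp [hsw']

/-- **Core of the chart transport.** For a base map `φ : A → A′` with Haar identity
`(√f(φ x))⁻¹|φ′ x| = w₀ x` and the fixed fibre chart `ψ(v) = (v²)⁻¹ : (0, s₁) → (x₁, ∞)` (Haar identity
`(√f(ψ v))⁻¹|ψ′ v| = 2/R v`), the source rep `rS = [A × (0,s₁), ĥ(s′) w₀(x) (2/R s′)]` and the target
rep `rT = [Φ(A × (0,s₁)), h(x′)/(√f x √f x′)]` differ by a relation: ONE application of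
`stub_translationStep` with `kS = ĥ`, `kT = h`, `kT ∘ ψ = kS`, potential `Q = 0`; the output rep
`[A, (Q 0 − Q s₁) w₀]` is the zero representation (`KZ.exists_zeroRep`), itself a relation
(`KZ.of_mem_relations_of_eqOn_zero`). [cite: KontsevichZagier2001, §1.2 rules (1)–(3)] -/
theorem chartTr_core {g₂ g₃ e₁ x₁ s₁ Cb : ℝ} {f R : ℝ → ℝ} (φ φ' w₀ : ℝ → ℝ) (A A' : Set ℝ)
    (rS rT : IntegralRep 2)
    (hf : ∀ x, f x = 4 * x ^ 3 - g₂ * x - g₃) (h₂ : IsAlgebraic ℚ g₂) (h₃ : IsAlgebraic ℚ g₃)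
    (hx₁ : IsAlgebraic ℚ x₁) (hs₁a : IsAlgebraic ℚ s₁) (hex : e₁ < x₁) (hs₁ : 0 < s₁)
    (hsx : s₁ ^ 2 * x₁ = 1) (hCb : ∀ x, e₁ < x → |(g₂ * x + 2 * g₃) / (4 * x ^ 2)| ≤ Cb)
    (hR : ∀ s, 0 < s → s ≤ s₁ → Real.sqrt (f (s ^ 2)⁻¹) = R s / s ^ 3)
    (hRpos : ∀ s ∈ Icc 0 s₁, 0 < R s) (hRc : ContinuousOn R (Icc 0 s₁))
    (hRsa : IsSemialgebraicFunOn ℚ {t : Fin 1 → ℝ | t 0 ∈ Icc 0 s₁} (fun t => R (t 0)))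
    (hA : IsSemialgebraic ℚ {t : Fin 1 → ℝ | t 0 ∈ A})
    (hA' : IsSemialgebraic ℚ {t : Fin 1 → ℝ | t 0 ∈ A'})
    (hφ : IsSemialgebraicFunOn ℚ {t : Fin 1 → ℝ | t 0 ∈ A} (fun t => φ (t 0)))
    (hφinj : InjOn φ A) (hφmaps : MapsTo φ A A')
    (hφder : ∀ x ∈ A, HasDerivAt φ (φ' x) x ∧ (Real.sqrt (f (φ x)))⁻¹ * |φ' x| = w₀ x)
    (hw₀ : IsSemialgebraicFunOn ℚ {t : Fin 1 → ℝ | t 0 ∈ A} (fun t => w₀ (t 0)))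
    (hw₀nn : ∀ x ∈ A, 0 ≤ w₀ x) (hw₀int : IntegrableOn w₀ A)
    (hSd : rS.domain = {z | z 0 ∈ A ∧ 0 < z 1 ∧ z 1 < s₁})
    (hSi : EqOn rS.integrand
      (fun z => (g₂ * (z 1) ^ 2 + 2 * g₃ * (z 1) ^ 4) / 4 * w₀ (z 0) * (2 / R (z 1))) rS.domain)
    (hTd : rT.domain = (fun z : Fin 2 → ℝ => (![φ (z 0), ((z 1) ^ 2)⁻¹] : Fin 2 → ℝ)) '' rS.domain)
    (hTi : EqOn rT.integrand (fun z => (g₂ * z 1 + 2 * g₃) / (4 * (z 1) ^ 2) /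
      (Real.sqrt (f (z 0)) * Real.sqrt (f (z 1)))) rT.domain) :
    of rT - of rS ∈ relations := by
  have hB : IsSemialgebraic ℚ {t : Fin 1 → ℝ | t 0 ∈ Ioo 0 s₁} :=
    (isSemialgebraic_setOf_const_lt_apply isAlgebraic_zero 0).inter
      (isSemialgebraic_setOf_apply_lt_const hs₁a 0)
  have hB' : IsSemialgebraic ℚ {t : Fin 1 → ℝ | t 0 ∈ Ioi x₁} :=
    isSemialgebraic_setOf_const_lt_apply hx₁ 0
  have hJ : IsSemialgebraic ℚ {t : Fin 1 → ℝ | t 0 ∈ Icc 0 s₁} :=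
    cornerLower_isSemialgebraic_slab isAlgebraic_zero hs₁a
  have hB'e : ∀ x ∈ Ioi x₁, e₁ < x := fun x hx => hex.trans hx
  -- `ℚ`-semialgebraicity of the chart data (closure rules, junk-tolerant inverse)
  have hX0 : IsSemialgebraicFunOn ℚ {t : Fin 1 → ℝ | t 0 ∈ Ioo 0 s₁} (fun t => t 0) :=
    (isSemialgebraicFunOn_aeval hB (X 0)).congr fun t _ => by simp
  have hX1 : IsSemialgebraicFunOn ℚ {t : Fin 1 → ℝ | t 0 ∈ Ioi x₁} (fun t => t 0) :=
    (isSemialgebraicFunOn_aeval hB' (X 0)).congr fun t _ => by simp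
  have hψ : IsSemialgebraicFunOn ℚ {t : Fin 1 → ℝ | t 0 ∈ Ioo 0 s₁} (fun t => ((t 0) ^ 2)⁻¹) :=
    (hX0.fun_pow 2).fun_inv
  have hu₀ : IsSemialgebraicFunOn ℚ {t : Fin 1 → ℝ | t 0 ∈ A'} (fun t => (Real.sqrt (f (t 0)))⁻¹) :=
    (isSemialgebraicFunOn_sqrt_cubic_apply hA' h₂ h₃ hf 0).fun_inv
  have hu₁ : IsSemialgebraicFunOn ℚ {t : Fin 1 → ℝ | t 0 ∈ Ioi x₁}
      (fun t => (Real.sqrt (f (t 0)))⁻¹) :=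
    (isSemialgebraicFunOn_sqrt_cubic_apply hB' h₂ h₃ hf 0).fun_inv
  have hkS : IsSemialgebraicFunOn ℚ {t : Fin 1 → ℝ | t 0 ∈ Ioo 0 s₁}
      (fun t => (g₂ * (t 0) ^ 2 + 2 * g₃ * (t 0) ^ 4) / 4) :=
    ((((isSemialgebraicFunOn_const_of_isAlgebraic hB h₂).fun_mul (hX0.fun_pow 2)).fun_add
      (((isSemialgebraicFunOn_const_ofNat hB 2).fun_mul
        (isSemialgebraicFunOn_const_of_isAlgebraic hB h₃)).fun_mul (hX0.fun_pow 4))).fun_mul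
      (isSemialgebraicFunOn_const_ofNat hB 4).fun_inv).congr fun _ _ => (div_eq_mul_inv _ _).symm
  have hkT : IsSemialgebraicFunOn ℚ {t : Fin 1 → ℝ | t 0 ∈ Ioi x₁}
      (fun t => (g₂ * t 0 + 2 * g₃) / (4 * (t 0) ^ 2)) :=
    ((((isSemialgebraicFunOn_const_of_isAlgebraic hB' h₂).fun_mul hX1).fun_add
      ((isSemialgebraicFunOn_const_ofNat hB' 2).fun_mul
        (isSemialgebraicFunOn_const_of_isAlgebraic hB' h₃))).fun_mul
      ((isSemialgebraicFunOn_const_ofNat hB' 4).fun_mul (hX1.fun_pow 2)).fun_inv).congr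
      fun _ _ => (div_eq_mul_inv _ _).symm
  have hw₁nn : ∀ v ∈ Ioo 0 s₁, 0 ≤ 2 / R v := fun v hv =>
    div_nonneg zero_le_two (hRpos v (Ioo_subset_Icc_self hv)).le
  -- the potential is the constant `0`: `kT ∘ ψ = kS` (the kernel identity of `cellStepZero_hhat_eq`)
  have hQd : ∀ x ∈ A, ∀ x' ∈ Ioo (0 : ℝ) s₁, HasDerivAt (fun _ : ℝ => (0 : ℝ))
      (-(((g₂ * (x' ^ 2)⁻¹ + 2 * g₃) / (4 * ((x' ^ 2)⁻¹) ^ 2) -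
        (g₂ * x' ^ 2 + 2 * g₃ * x' ^ 4) / 4) * (2 / R x'))) x' := by
    intro x _ x' hx'
    refine (hasDerivAt_const x' (0 : ℝ)).congr_deriv ?_
    have hx0 : x' ≠ 0 := hx'.1.ne'
    have hk : (g₂ * (x' ^ 2)⁻¹ + 2 * g₃) / (4 * ((x' ^ 2)⁻¹) ^ 2) =
        (g₂ * x' ^ 2 + 2 * g₃ * x' ^ 4) / 4 := by
      field_simp
    rw [hk, sub_self, zero_mul, neg_zero]
  have hTi' : EqOn rT.integrand (fun z => (g₂ * z 1 + 2 * g₃) / (4 * (z 1) ^ 2) *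
      (Real.sqrt (f (z 0)))⁻¹ * (Real.sqrt (f (z 1)))⁻¹) rT.domain := fun z hz => by
    rw [hTi hz]
    ring
  -- the output representation: zero integrand on `A`
  obtain ⟨rO, hOd, hOi⟩ := exists_zeroRep hA
  have hOi' : EqOn rO.integrand (fun t => ((0 : ℝ) - 0) * w₀ (t 0)) rO.domain := fun t _ => by
    simp [hOi]
  have hstep : of rT - of rS - of rO ∈ relations :=
    stub_translationStep φ φ' (fun v => (v ^ 2)⁻¹) (fun v => -2 / v ^ 3)
      (fun v => (g₂ * v ^ 2 + 2 * g₃ * v ^ 4) / 4) (fun x => (g₂ * x + 2 * g₃) / (4 * x ^ 2))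
      w₀ (fun v => 2 / R v) (fun x => (Real.sqrt (f x))⁻¹) (fun x => (Real.sqrt (f x))⁻¹)
      (fun _ => 0) (fun _ => 0) (fun _ => s₁) A (Ioo 0 s₁) A' (Ioi x₁) (Icc 0 s₁) Cb rS rT rO
      hA hB hA' hB' hJ hφ hψ hφinj (chartTr_injOn_invSq s₁) hφmaps
      (fun _ hv => sigmaChart_lt_inv_sq hsx hv.1 hv.2) hφder (chartTr_hasDerivAt_haar hR) hw₀
      (chartTr_sa_twoDivR hs₁a hRsa) hu₀ hu₁ hkS hkT (chartTr_hHat_bound hex hsx hCb)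
      (fun x hx => hCb x (hB'e x hx)) hw₀nn hw₁nn hw₀int (chartTr_integrableOn_twoDivR hRc hRpos)
      (isSemialgebraicFunOn_const_of_isAlgebraic hA isAlgebraic_zero)
      (isSemialgebraicFunOn_const_of_isAlgebraic hA hs₁a) (fun _ _ => hs₁) (fun _ _ => Subset.rfl)
      (fun _ _ => Subset.rfl) (isSemialgebraicFunOn_const_of_isAlgebraic hJ isAlgebraic_zero)
      (fun _ _ => continuousOn_const) hQd hSd hSi hTd hTi' hOd hOi'
  have hO : of rO ∈ relations :=
    of_mem_relations_of_eqOn_zero rO (by rw [hOi]; exact fun _ _ => rfl)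
  have e : of rT - of rS = of rT - of rS - of rO + of rO := by abel
  rw [e]
  exact relations.add_mem hstep hO

/-- **STUB S7 (`stub_chartTransportInst`, size M) — the two chart transports of the corner cell (no potential).**
The chart `x′ = s′⁻²` carries `[(al,ar) × (0,s₁), ĥ(s′)(1/√f x)(2/R s′)]` to `[(al,ar) × (x₁,∞), h(x′)/(√f√f′)]`, and
`(x, x′) = (s⁻², s′⁻²)` carries `[(0,s₁)², ĥ(s′)(2/R s)(2/R s′)]` to `[(x₁,∞)², h(x′)/(√f√f′)]`: two applications of
`stub_translationStep` with `kT∘ψ = kS` (so `Q = 0` and the output rep is a relation by itself,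
`KZ.of_mem_relations_of_eqOn_zero`), Haar identity `(1/√f(s⁻²))·|−2/s³| = 2/R(s)`. [cite: KontsevichZagier2001, §1.2] -/
theorem stub_chartTransportInst :
    ∀ (g₂ g₃ e₁ al ar x₁ s₁ Cb : ℝ) (f R : ℝ → ℝ)
      (Cmix Cx B00 Bx : Literature.NumberTheory.Transcendental.KZ.IntegralRep 2),
    (∀ x, f x = 4 * x ^ 3 - g₂ * x - g₃) → IsAlgebraic ℚ g₂ → IsAlgebraic ℚ g₃ →
    IsAlgebraic ℚ al → IsAlgebraic ℚ ar → IsAlgebraic ℚ x₁ → IsAlgebraic ℚ s₁ →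
    0 < e₁ → e₁ < al → al < ar → e₁ < x₁ → 0 < s₁ → s₁ ^ 2 * x₁ = 1 → (∀ x, e₁ < x → 0 < f x) →
    (∀ x, e₁ < x → |(g₂ * x + 2 * g₃) / (4 * x ^ 2)| ≤ Cb) →
    MeasureTheory.IntegrableOn (fun t => (Real.sqrt (f t))⁻¹) (Set.Ioo al ar) →
    (∀ s, 0 < s → s ≤ s₁ → Real.sqrt (f (s ^ 2)⁻¹) = R s / s ^ 3) →
    (∀ s ∈ Set.Icc 0 s₁, 0 < R s) → ContinuousOn R (Set.Icc 0 s₁) →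
    IsSemialgebraicFunOn ℚ {t : Fin 1 → ℝ | t 0 ∈ Set.Icc 0 s₁} (fun t => R (t 0)) →
    Cmix.domain = {z | (al < z 0 ∧ z 0 < ar) ∧ 0 < z 1 ∧ z 1 < s₁} →
    Set.EqOn Cmix.integrand
      (fun z => (g₂ * (z 1) ^ 2 + 2 * g₃ * (z 1) ^ 4) / 4 * (Real.sqrt (f (z 0)))⁻¹ * (2 / R (z 1))) Cmix.domain →
    Cx.domain = {z | (al < z 0 ∧ z 0 < ar) ∧ x₁ < z 1} →
    Set.EqOn Cx.integrand
      (fun z => (g₂ * z 1 + 2 * g₃) / (4 * (z 1) ^ 2) / (Real.sqrt (f (z 0)) * Real.sqrt (f (z 1)))) Cx.domain →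
    B00.domain = {z | (0 < z 0 ∧ z 0 < s₁) ∧ 0 < z 1 ∧ z 1 < s₁} →
    Set.EqOn B00.integrand
      (fun z => (g₂ * (z 1) ^ 2 + 2 * g₃ * (z 1) ^ 4) / 4 * (2 / R (z 0)) * (2 / R (z 1))) B00.domain →
    Bx.domain = {z | x₁ < z 0 ∧ x₁ < z 1} →
    Set.EqOn Bx.integrand
      (fun z => (g₂ * z 1 + 2 * g₃) / (4 * (z 1) ^ 2) / (Real.sqrt (f (z 0)) * Real.sqrt (f (z 1)))) Bx.domain →
    Literature.NumberTheory.Transcendental.KZ.of Cx - Literature.NumberTheory.Transcendental.KZ.of Cmix ∈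
        Literature.NumberTheory.Transcendental.KZ.relations ∧
      Literature.NumberTheory.Transcendental.KZ.of Bx - Literature.NumberTheory.Transcendental.KZ.of B00 ∈
        Literature.NumberTheory.Transcendental.KZ.relations := by
  intro g₂ g₃ e₁ al ar x₁ s₁ Cb f R Cmix Cx B00 Bx hf h₂ h₃ hal har hx₁ hs₁a _he₁ _heal _halar hex hs₁ hsx
    _hfpos hCb hIoo hR hRpos hRc hRsa hCmixd hCmixi hCxd hCxi hB00d hB00i hBxd hBxi
  have hA : IsSemialgebraic ℚ {t : Fin 1 → ℝ | t 0 ∈ Ioo al ar} :=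
    (isSemialgebraic_setOf_const_lt_apply hal 0).inter (isSemialgebraic_setOf_apply_lt_const har 0)
  have hB : IsSemialgebraic ℚ {t : Fin 1 → ℝ | t 0 ∈ Ioo 0 s₁} :=
    (isSemialgebraic_setOf_const_lt_apply isAlgebraic_zero 0).inter
      (isSemialgebraic_setOf_apply_lt_const hs₁a 0)
  have hB' : IsSemialgebraic ℚ {t : Fin 1 → ℝ | t 0 ∈ Ioi x₁} :=
    isSemialgebraic_setOf_const_lt_apply hx₁ 0
  refine ⟨?_, ?_⟩
  · -- (i) the mixed cell: `φ = id` on `(al, ar)`, `ψ = (v²)⁻¹` on `(0, s₁)`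
    have hw₀ : IsSemialgebraicFunOn ℚ {t : Fin 1 → ℝ | t 0 ∈ Ioo al ar}
        (fun t => (Real.sqrt (f (t 0)))⁻¹) :=
      (isSemialgebraicFunOn_sqrt_cubic_apply hA h₂ h₃ hf 0).fun_inv
    have hφ : IsSemialgebraicFunOn ℚ {t : Fin 1 → ℝ | t 0 ∈ Ioo al ar} (fun t => t 0) :=
      (isSemialgebraicFunOn_aeval hA (X 0)).congr fun t _ => by simp
    have hφder : ∀ x ∈ Ioo al ar, HasDerivAt (fun x : ℝ => x) 1 x ∧
        (Real.sqrt (f x))⁻¹ * |(1 : ℝ)| = (Real.sqrt (f x))⁻¹ := fun x _ =>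
      ⟨hasDerivAt_id' (x := x), by rw [abs_one, mul_one]⟩
    have hSd : Cmix.domain = {z | z 0 ∈ Ioo al ar ∧ 0 < z 1 ∧ z 1 < s₁} := by rw [hCmixd]; rfl
    have hTd : Cx.domain =
        (fun z : Fin 2 → ℝ => (![z 0, ((z 1) ^ 2)⁻¹] : Fin 2 → ℝ)) '' Cmix.domain := by
      rw [hCxd, hCmixd]
      exact (chartTr_image_mixed hs₁ hsx).symm
    exact chartTr_core (fun x => x) (fun _ => 1) (fun x => (Real.sqrt (f x))⁻¹) (Ioo al ar)
      (Ioo al ar) Cmix Cx hf h₂ h₃ hx₁ hs₁a hex hs₁ hsx hCb hR hRpos hRc hRsa hA hA hφ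
      (fun _ _ _ _ h => h) (fun _ hx => hx) hφder hw₀ (fun x _ => inv_nonneg.2 (Real.sqrt_nonneg _))
      hIoo hSd hCmixi hTd hCxi
  · -- (ii) the chart square: `φ = ψ = (v²)⁻¹` on `(0, s₁)`
    have hX0 : IsSemialgebraicFunOn ℚ {t : Fin 1 → ℝ | t 0 ∈ Ioo 0 s₁} (fun t => t 0) :=
      (isSemialgebraicFunOn_aeval hB (X 0)).congr fun t _ => by simp
    have hφ : IsSemialgebraicFunOn ℚ {t : Fin 1 → ℝ | t 0 ∈ Ioo 0 s₁} (fun t => ((t 0) ^ 2)⁻¹) :=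
      (hX0.fun_pow 2).fun_inv
    have hSd : B00.domain = {z | z 0 ∈ Ioo 0 s₁ ∧ 0 < z 1 ∧ z 1 < s₁} := by rw [hB00d]; rfl
    have hTd : Bx.domain =
        (fun z : Fin 2 → ℝ => (![((z 0) ^ 2)⁻¹, ((z 1) ^ 2)⁻¹] : Fin 2 → ℝ)) '' B00.domain := by
      rw [hBxd, hB00d]
      exact (chartTr_image_square hs₁ hsx).symm
    exact chartTr_core (fun v => (v ^ 2)⁻¹) (fun v => -2 / v ^ 3) (fun v => 2 / R v) (Ioo 0 s₁)
      (Ioi x₁) B00 Bx hf h₂ h₃ hx₁ hs₁a hex hs₁ hsx hCb hR hRpos hRc hRsa hB hB' hφ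
      (chartTr_injOn_invSq s₁) (fun _ hv => sigmaChart_lt_inv_sq hsx hv.1 hv.2)
      (chartTr_hasDerivAt_haar hR) (chartTr_sa_twoDivR hs₁a hRsa)
      (fun v hv => div_nonneg zero_le_two (hRpos v (Ioo_subset_Icc_self hv)).le)
      (chartTr_integrableOn_twoDivR hRc hRpos) hSd hB00i hTd hBxi

end Summit.KontsevichZagierPeriods.KontsevichZagierPeriods.Cruxes.NeronTorsionSector.Translation

end
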